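import Summits.BirchSwinnertonDyer.BirchSwinnertonDyer.Theses.ErratumRoadFive
import Summits.BirchSwinnertonDyer.Rank1Residual.X11b.RouteOpenInputsAgree
import Summits.BirchSwinnertonDyer.Rank1Residual.X11b.RouteR1BDPValueCoreFrame
import Summits.BirchSwinnertonDyer.Rank1Residual.X11b.BDPRouteErratumDataRecord
import HarnessLib

/-!
# Route `ErratumRoadFive`, crux `OpenInputIMC` (item stmt-BirchSwinnertonDyer-19061): the REDUCTION of
# the (ram) sub-locus `R1Population ∩ Locus` to the erratum currency (H2 + H3 at erratum data), and the
# planner's split lemmas, kernel-checked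

Cell `bsd-stepL` (run/shared/lean/pub/bsd-stepL/), seat `bsd-stepL-imc-p1` (prover; D-0074 row A),
`--supports stmt-BirchSwinnertonDyer-19061`. HONEST FRAMING: nothing here proves the crux; BSD is not
proved by any of this; every published ∕ cited named fact below is a HYPOTHESIS and the two
erratum-currency shapes (H2, H3) are typed OPEN inputs. THEOREMS ONLY (no definition, no named fact,
no `sorry`); pure composition of landed kernels of the cells `b2b-bsdres` (multr1-p1 ∕ multr1-p2 ∕
x11b3) and `bsd-stepL` (bdp, p408571).

## What the crux is, and where its only announced derivation lives

`OpenInputIMC = ∀ W p, X11b.P2OpenInputOnTreeAt W p`: at every CLASSICAL Heegner datum (every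
`ℓ ∣ N_E` split in `K`) of an X11b pair (`r_an = 1`, `p ∥ N`, `E[p]` irreducible) with `p ≥ 5` and
`ρ̄` onto, the inequality (IMC≥)∘(BDP) at `𝟙`, `2·(ord_p log_ω P − 1) ≤ ord_p f_ac(0)`. Its only
announced derivation at `p ∥ N` — Castella's erratum (2.4) "By [FW21, Thm. 4.41]" (+ the erratum's
Hida descent (a)–(c), [Cas20, Thm. 2.11]) — requires "a prime `q ∥ N` NOT split in `K`" at which
`E` is NON-split multiplicative with `E[p]` ramified (erratum Thm. 1.1 (iii)) and `E(ℚ_p)[p] = 0`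
(iv): it lives at the ERRATUM data of route R1 (`IsErratumField`: `q` ramified in `K`), never at
classical Heegner data. The tree's erratum currency for it is the value-free ONE-SIDED shape
**H3 = `P2.IMCDivIntCoreFrameAtErratumData W p`** (X11b/BDPRouteErratumData.lean; the object of
bdp's Road HF ∕ THEOREM HF♯, PROOF-BDP §13 ∕ §24) together with the value shape
**H2 = `R1.BDPValueCoreFrameOnTree W p`** (X11b/RouteR1BDPValueCoreFrame.lean; bdp's THEOREM C♯,
PROOF-BDP §21; print on the semistable part, Cas18 Thms. 3.1–3.2).

## What this file proves

* §1 **`openInputOnTreeAt_of_r1Population_of_not_dvd_of_coreFrames`** — for `(W, p)` on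
  `R1Population W p` (the A′-hypotheses at `p ≥ 5` + a second `E[p]`-ramified multiplicative prime +
  an odd NON-split `E[p]`-ramified `q ≠ p`) with `p ∤ ∏_ℓ c_ℓ(E)`: H2 ∧ H3 ⟹ `P2OpenInputOnTreeAt W p`,
  from 11 PUBLISHED + 5 CITED named facts. Mechanism: the hybrid record
  `P2.bsdp_of_r1Population_of_not_dvd_of_bdpValueCoreFrame_of_imcDivIntCoreFrameAtErratumData`
  (bdp, p408571: lower half from H2 + H3 at an erratum field, upper half = Kolyvagin at a classical
  field) gives `BSD(E,p)`; the control identity on the Locus is a theorem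
  (`p2ControlOnTreeAt_of_locus`, x11b3); tightness `P2.openInputOnTreeAt_of_bsdp_of_ram` (multr1-p2)
  turns `BSD(E,p)` back into the open input at EVERY classical datum of the pair. Variants: from the
  with-value shape `P2.IMCDivIntFrameAtErratumData` alone; from route R1's equality shape.
* §2 the CLASS-LEVEL form and the planner's SPLIT LEMMAS: `OpenInputIMC` ⟺ its (ram) part ∧ its
  ¬(ram) part; `OpenInputIMC` ⟸ its `R1Population ∩ Locus` part ∧ the rest; hence
  **`openInputIMC_of_coreFrames_of_rest`**: (∀ H2) → (∀ H3) → facts → [the crux OFF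
  `R1Population ∩ Locus`] → `OpenInputIMC`.
* §3 the A′-BINDER variant: with the erratum's Thm. A′ taken WHOLE as the existing OPEN Literature
  binder `Castella2018.erratum_thmAprime_padicVal_bsd_rankOne_OPEN` (PRE; its printed proof silently
  needs the second prime — cell flag CAS18-ERR-ram2), the crux holds on `ErratumHypotheses ∩ Locus`.

HONEST LOCUS (census of record, multr1-p1 `census500k`, `N < 5·10⁵`, X11b-shape pairs at `p ≥ 5`):
`R1Population ∩ Locus` = 1 201 479 of 2 267 348 (53.0 %); the (ram) Locus is 2 093 111 (92.3 %). The
erratum road does NOT reach all of (ram) ∧ surj: outside it stay the (ram) sub-atoms "every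
`E[p]`-ramified multiplicative `q ≠ p` is split" (erratum (iii)), "no second ramified multiplicative
prime" (CAS18-ERR-ram2: Skinner 2016 Thm. C (ii) for the twist), "`q = 2` only" ([Cas20] odd `d_K`),
"`E(ℚ_p)[p] ≠ 0`" (erratum (iv)) and `p ∣ ∏c` (off the Locus). CONDITIONAL; nothing booked; no label
changes; closes rung K2 of BirchSwinnertonDyer for NO pair by itself.

References: [Castella2018Erratum] Thm. 1.1 (i)–(iv), (2.4), Thm. A′ (pp. 1, 4); [Castella2018] Thms.
2.3, 3.1, 3.2, §5 (arXiv:1704.06608 pp. 5, 9, 12); [FouquetWan2021] arXiv:2107.13726 Thm. 4.41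
(PREPRINT); [JetchevSkinnerWan2017] Thm. 3.3.1, §7.4.1; [Skinner2016PacificMC] Thm. C;
[CaiShuTian2014] Thm. 1.1; [FriedbergHoffstein1995] Thm. B; [HoffsteinLuo1997]; [McCallumLMS1991] §1;
[Mazur1978] Cor. 4.1; [MilneADT2006] I.4.10, I.2.8; [Miller2011LMS] Def. 1.1.
-/

set_option autoImplicit false

noncomputable section

open scoped Classical

open WeierstrassCurve NumberField IsDedekindDomain Field
open Literature.NumberTheory.EllipticCurves Literature.NumberTheory.EllipticCurves.GreenbergSelmer
open Literature.NumberTheory.EllipticCurves.ModularForms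
open Literature.NumberTheory.EllipticCurves.Rank1Residual
open Literature.NumberTheory.EllipticCurves.Rank1Residual.Typed
open Literature.NumberTheory.EllipticCurves.Wuthrich2014
open Literature.NumberTheory.EllipticCurves.Castella2018
open Literature.NumberTheory.GaloisRepresentations
open Literature.NumberTheory.GaloisCohomology
open Summit.BirchSwinnertonDyer.Rank1Residual Summit.BirchSwinnertonDyer.Rank1Residual.X11b
open Summit.BirchSwinnertonDyer.BirchSwinnertonDyer.Theses

namespace Summit.BirchSwinnertonDyer.BirchSwinnertonDyer.Theorems

/-! ### §1 Pair level: the open input on `R1Population ∩ Locus` from H2 + H3 at erratum data -/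

section Pair

variable (W : WeierstrassCurve ℚ) [W.IsElliptic] [W.IsGloballyMinimal] (p : ℕ) [Fact p.Prime]

/-- **THE REDUCTION (pair level).** For a globally minimal elliptic `W/ℚ` and a prime `p` with
`R1Population W p` and `p ∤ ∏_ℓ c_ℓ(E)`: route p2's open input `P2OpenInputOnTreeAt W p` — the
inequality (IMC≥)∘(BDP) at `𝟙` at EVERY odd-`d_K` Manin-good CLASSICAL Heegner datum of the pair —
follows from the two erratum-currency shapes H2 = `R1.BDPValueCoreFrameOnTree W p` (the BDP value at
`𝟙` for some `R₀`-frame at every erratum datum; cell bsd-stepL THEOREM C♯, print on semistable `E`)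
and H3 = `P2.IMCDivIntCoreFrameAtErratumData W p` (the ONE divisibility
`Ch_Λ(X_ac^∅(E[p^∞]))·𝓞_{ℂ_p}⟦T⟧ ⊆ (Q)` for some ♭-frame at every erratum datum; erratum (2.4) ⇐
[FW21, Thm. 4.41] + Hida descent, PREPRINT; bdp Road HF ∕ HF♯), given ELEVEN published named facts
(`hGZ86` Gross–Zagier 1986 I.7.3, `hGZK`, `hSk` Skinner 2016 Thm. C, `hnf` modularity, `hCST`
Cai–Shu–Tian 2014 Thm. 1.1, `hFH` Friedberg–Hoffstein (ramified form), `hMaz` Mazur 1978 Cor. 4.1,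
`hGZ` ∕ `hKo` Gross–Zagier ∕ Kolyvagin over `K`, `hB` Kolyvagin 1990, `hHL` Hoffstein–Luo) and FIVE
cited ones (`hPTs`, `hPT`, `hPT2` Poitou–Tate ×3, `hEP` local Euler–Poincaré, `hcd` `cd_p ≤ 2`).
Proof: `r_an = 1` is a binder of the open input; the hybrid record (p408571) gives `BSD(E,p)`; the
control identity on the Locus (`p2ControlOnTreeAt_of_locus`) and tightness
(`P2.openInputOnTreeAt_of_bsdp_of_ram`) give the open input. CONDITIONAL on H2, H3; nothing booked.
[cite: Castella2018Erratum, Thm. 1.1 (iii)–(iv) and (2.4) (pp. 1, 4)]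
[cite: Castella2018, Thm. 2.3 (p. 5), Thms. 3.1–3.2 (p. 9), §5 (p. 12) (arXiv:1704.06608)]
[cite: JetchevSkinnerWan2017, Thm. 3.3.1 and §7.4.1 (arXiv:1512.06894 pp. 11, 30)]
[cite: Skinner2016PacificMC, Thm. C (§1)] [cite: McCallumLMS1991, §1 Theorem (Kolyvagin), p. 296]
[cite: Miller2011LMS, Def. 1.1] -/
theorem openInputOnTreeAt_of_r1Population_of_not_dvd_of_coreFrames
    -- route R1's published inputs
    (hGZ86 : GrossZagier1986_thm_I_7_3) (hGZK : rank_eq_analyticRank_of_analyticRank_le_one)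
    (hSk : Skinner2016.thmC_padicValRat_bsd_rank_zero) (hnf : exists_isNewformOf)
    (hCST : CaiShuTian2014.thm11_trivialChar)
    (hFH : friedbergHoffstein_exists_twist_ne_zero_ramifiedAt)
    (hMaz : mazur_not_dvd_maninConstant_of_odd)
    -- route p2's published inputs at a classical Heegner field
    (hGZ : ∀ (N : ℕ) [NeZero N] (W : WeierstrassCurve ℚ) (K : Type) [Field K] [NumberField K],
      gross_zagier N W K)
    (hKo : ∀ (N : ℕ) [NeZero N] (W : WeierstrassCurve ℚ) (K : Type) [Field K] [NumberField K],
      kolyvagin N W K)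
    (hB : ∀ (N : ℕ) [NeZero N] (W : WeierstrassCurve ℚ) (K : Type) [Field K] [NumberField K],
      Kolyvagin1990_padicValNat_card_sha_le N W K)
    (hHL : HoffsteinLuo1997_exists_twist_L_one_ne_zero)
    -- cited
    (hPTs : ∀ (K : Type) [Field K] [NumberField K], poitouTate_sum_localTatePairing_eq_zero K)
    (hPT : ∀ (K : Type) [Field K] [NumberField K], poitouTate_selmerStructure_duality K)
    (hPT2 : ∀ (K : Type) [Field K] [NumberField K], poitouTate_sha_tateDual K)
    (hEP : ∀ (K : Type) [Field K] [NumberField K] (v : HeightOneSpectrum (𝓞 K)),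
      localEulerPoincareCharacteristic (v.adicCompletion K))
    (hcd : fieldCdLE_two_of_numberField)
    -- the two erratum-currency shapes (OPEN)
    (h2 : R1.BDPValueCoreFrameOnTree W p) (h3 : P2.IMCDivIntCoreFrameAtErratumData W p)
    -- the pair: on `R1Population ∩ Locus`
    (hW : R1Population W p) (htam : ¬ p ∣ W.tamagawaProduct) : P2OpenInputOnTreeAt W p := by
  refine p2OpenInputOnTreeAt_of_imp (W := W) (p := p) fun hX _hp5 ↦ ?_
  have hr : W.analyticRank = 1 := hX.1
  have hram : Ram W p := hW.1.ram
  have hbsd : BSDp W p :=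
    P2.bsdp_of_r1Population_of_not_dvd_of_bdpValueCoreFrame_of_imcDivIntCoreFrameAtErratumData
      hGZ86 hGZK hSk hnf hCST hFH hMaz hGZ hKo hB hHL hPTs hEP h2 h3 hW hr htam
  exact P2.openInputOnTreeAt_of_bsdp_of_ram W p hGZ hKo hSk hGZK
    (hasEntireLFunction_rat_of_exists_isNewformOf hnf)
    (p2ControlOnTreeAt_of_locus W p hKo hPT hPT2 hEP hcd hX hram htam) hram hbsd

/-- **Variant from the with-value shape alone**: on `R1Population ∩ Locus`, route p2's open input from
`P2.IMCDivIntFrameAtErratumData W p` ((2.4)♭ one-sided WITH the value conjunct, for SOME ♭-frame at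
every erratum datum — bdp's TARGET E) and the same 11 + 5 facts, through the hybrid record
`P2.bsdp_of_r1Population_of_not_dvd_of_imcDivIntFrameAtErratumData` (multr1-p2 gen 28).
CONDITIONAL; nothing booked. [cite: Castella2018Erratum, (2.4), Thm. 2.3 (p. 4)]
[cite: Castella2018, Thms. 3.1–3.2 (arXiv:1704.06608 p. 9), §5 (p. 12)] [cite: Miller2011LMS, Def. 1.1] -/
theorem openInputOnTreeAt_of_r1Population_of_not_dvd_of_imcDivIntFrameAtErratumData
    (hGZ86 : GrossZagier1986_thm_I_7_3) (hGZK : rank_eq_analyticRank_of_analyticRank_le_one)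
    (hSk : Skinner2016.thmC_padicValRat_bsd_rank_zero) (hnf : exists_isNewformOf)
    (hCST : CaiShuTian2014.thm11_trivialChar)
    (hFH : friedbergHoffstein_exists_twist_ne_zero_ramifiedAt)
    (hMaz : mazur_not_dvd_maninConstant_of_odd)
    (hGZ : ∀ (N : ℕ) [NeZero N] (W : WeierstrassCurve ℚ) (K : Type) [Field K] [NumberField K],
      gross_zagier N W K)
    (hKo : ∀ (N : ℕ) [NeZero N] (W : WeierstrassCurve ℚ) (K : Type) [Field K] [NumberField K],
      kolyvagin N W K)
    (hB : ∀ (N : ℕ) [NeZero N] (W : WeierstrassCurve ℚ) (K : Type) [Field K] [NumberField K],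
      Kolyvagin1990_padicValNat_card_sha_le N W K)
    (hHL : HoffsteinLuo1997_exists_twist_L_one_ne_zero)
    (hPTs : ∀ (K : Type) [Field K] [NumberField K], poitouTate_sum_localTatePairing_eq_zero K)
    (hPT : ∀ (K : Type) [Field K] [NumberField K], poitouTate_selmerStructure_duality K)
    (hPT2 : ∀ (K : Type) [Field K] [NumberField K], poitouTate_sha_tateDual K)
    (hEP : ∀ (K : Type) [Field K] [NumberField K] (v : HeightOneSpectrum (𝓞 K)),
      localEulerPoincareCharacteristic (v.adicCompletion K))
    (hcd : fieldCdLE_two_of_numberField)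
    (hD : P2.IMCDivIntFrameAtErratumData W p)
    (hW : R1Population W p) (htam : ¬ p ∣ W.tamagawaProduct) : P2OpenInputOnTreeAt W p := by
  refine p2OpenInputOnTreeAt_of_imp (W := W) (p := p) fun hX _hp5 ↦ ?_
  have hr : W.analyticRank = 1 := hX.1
  have hram : Ram W p := hW.1.ram
  have hbsd : BSDp W p :=
    P2.bsdp_of_r1Population_of_not_dvd_of_imcDivIntFrameAtErratumData W p hGZ86 hGZK hSk hnf hCST
      hFH hMaz hGZ hKo hB hHL hPTs hEP hD hW hr htam
  exact P2.openInputOnTreeAt_of_bsdp_of_ram W p hGZ hKo hSk hGZK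
    (hasEntireLFunction_rat_of_exists_isNewformOf hnf)
    (p2ControlOnTreeAt_of_locus W p hKo hPT hPT2 hEP hcd hX hram htam) hram hbsd

/-- **The A′-BINDER variant (weaker evidence, larger locus).** For `(W, p)` on the erratum's
A′-hypotheses `ErratumHypotheses W p` (`5 ≤ p`, `mult(p)`, `irr(p)`, a NON-split multiplicative
`q ≠ p` with `E[p]` ramified, `E(ℚ_p)[p] = 0`) with `p ∤ ∏_ℓ c_ℓ(E)`: route p2's open input from the
erratum's Thm. A′ taken WHOLE as the tree's OPEN binder
`Castella2018.erratum_thmAprime_padicVal_bsd_rankOne_OPEN` (UNREFEREED; ⇐ erratum Thm. 1.1 ⇐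
[FW21, Thm. 4.41]; the cell's reading is that "the same argument as in [Cas18, §5]" silently needs a
second ramified multiplicative prime — flag CAS18-ERR-ram2 —, which is why §1 works on `R1Population`
instead), plus `hGZ hKo hSk hGZK hnf` and the cited control facts. `BSD(E,p)` by
`bsdp_of_erratumHypotheses_of_thmAprime_OPEN`; then control-on-Locus and tightness as in §1.
CONDITIONAL on an unrefereed claim; nothing booked. [claim: Castella2018Erratum, status: under-review]
[cite: JetchevSkinnerWan2017, Thm. 3.3.1 and §7.4.1 (arXiv:1512.06894 pp. 11, 30)]
[cite: Castella2018, Thm. 2.3 (p. 5), Thm. 3.2 (p. 9)] [cite: Miller2011LMS, Def. 1.1] -/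
theorem openInputOnTreeAt_of_erratumHypotheses_of_not_dvd_of_thmAprime_OPEN
    (hA' : Castella2018.erratum_thmAprime_padicVal_bsd_rankOne_OPEN)
    (hGZ : ∀ (N : ℕ) [NeZero N] (W : WeierstrassCurve ℚ) (K : Type) [Field K] [NumberField K],
      gross_zagier N W K)
    (hKo : ∀ (N : ℕ) [NeZero N] (W : WeierstrassCurve ℚ) (K : Type) [Field K] [NumberField K],
      kolyvagin N W K)
    (hSk : Skinner2016.thmC_padicValRat_bsd_rank_zero)
    (hGZK : rank_eq_analyticRank_of_analyticRank_le_one) (hnf : exists_isNewformOf)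
    (hPT : ∀ (K : Type) [Field K] [NumberField K], poitouTate_selmerStructure_duality K)
    (hPT2 : ∀ (K : Type) [Field K] [NumberField K], poitouTate_sha_tateDual K)
    (hEP : ∀ (K : Type) [Field K] [NumberField K] (v : HeightOneSpectrum (𝓞 K)),
      localEulerPoincareCharacteristic (v.adicCompletion K))
    (hcd : fieldCdLE_two_of_numberField)
    (hE : ErratumHypotheses W p) (htam : ¬ p ∣ W.tamagawaProduct) : P2OpenInputOnTreeAt W p := by
  refine p2OpenInputOnTreeAt_of_imp (W := W) (p := p) fun hX _hp5 ↦ ?_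
  have hr : W.analyticRank = 1 := hX.1
  have hram : Ram W p := X11.ram_of_aprimeLocusAt hE.2.2.2
  have hbsd : BSDp W p := bsdp_of_erratumHypotheses_of_thmAprime_OPEN W p hA' hGZK hE hr
  exact P2.openInputOnTreeAt_of_bsdp_of_ram W p hGZ hKo hSk hGZK
    (hasEntireLFunction_rat_of_exists_isNewformOf hnf)
    (p2ControlOnTreeAt_of_locus W p hKo hPT hPT2 hEP hcd hX hram htam) hram hbsd

end Pair

/-! ### §2 Class level: the planner's split lemmas and the reduction of `OpenInputIMC` -/

section Split

/-- **Split lemma (ram ∕ ¬ram), kernel-checked for the planner.** The crux `OpenInputIMC` is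
EQUIVALENT to the conjunction of its (ram) part — `P2OpenInputOnTreeAt W p` for the pairs WITH a
multiplicative `q ≠ p` at which `E[p]` is ramified (`Ram W p`) — and its ¬(ram) part. (The open input
is vacuous off X11b ∧ `p ≥ 5` ∧ surj, which are binders inside it.) Bookkeeping only. [folklore] -/
theorem openInputIMC_iff_ram_and_not_ram :
    ErratumRoadFive.OpenInputIMC ↔
      (∀ (W : WeierstrassCurve ℚ) [W.IsElliptic] [W.IsGloballyMinimal] (p : ℕ) [Fact p.Prime],
          Ram W p → P2OpenInputOnTreeAt W p) ∧
        ∀ (W : WeierstrassCurve ℚ) [W.IsElliptic] [W.IsGloballyMinimal] (p : ℕ) [Fact p.Prime],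
          ¬ Ram W p → P2OpenInputOnTreeAt W p := by
  unfold ErratumRoadFive.OpenInputIMC
  refine ⟨fun h ↦ ⟨fun W _ _ p _ _ ↦ h W p, fun W _ _ p _ _ ↦ h W p⟩, fun h W _ _ p _ ↦ ?_⟩
  by_cases hram : Ram W p
  · exact h.1 W p hram
  · exact h.2 W p hram

/-- **Split lemma (erratum sub-locus ∕ rest), kernel-checked for the planner.** `OpenInputIMC`
follows from its `R1Population ∩ Locus` part (the sub-locus of (ram) reached by the erratum road:
A′-hypotheses + second ramified multiplicative prime + odd non-split ramified `q`, and
`p ∤ ∏_ℓ c_ℓ(E)`) together with the part OFF that sub-locus. Bookkeeping only. [folklore] -/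
theorem openInputIMC_of_r1Locus_of_rest
    (hR1 : ∀ (W : WeierstrassCurve ℚ) [W.IsElliptic] [W.IsGloballyMinimal] (p : ℕ) [Fact p.Prime],
      R1Population W p → ¬ p ∣ W.tamagawaProduct → P2OpenInputOnTreeAt W p)
    (hrest : ∀ (W : WeierstrassCurve ℚ) [W.IsElliptic] [W.IsGloballyMinimal] (p : ℕ) [Fact p.Prime],
      ¬ (R1Population W p ∧ ¬ p ∣ W.tamagawaProduct) → P2OpenInputOnTreeAt W p) :
    ErratumRoadFive.OpenInputIMC := by
  unfold ErratumRoadFive.OpenInputIMC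
  intro W _ _ p _
  by_cases h : R1Population W p ∧ ¬ p ∣ W.tamagawaProduct
  · exact hR1 W p h.1 h.2
  · exact hrest W p h

/-- The converse bookkeeping: `OpenInputIMC` gives both parts back (so the split loses nothing).
[folklore] -/
theorem openInputIMC_iff_r1Locus_and_rest :
    ErratumRoadFive.OpenInputIMC ↔
      (∀ (W : WeierstrassCurve ℚ) [W.IsElliptic] [W.IsGloballyMinimal] (p : ℕ) [Fact p.Prime],
          R1Population W p → ¬ p ∣ W.tamagawaProduct → P2OpenInputOnTreeAt W p) ∧
        ∀ (W : WeierstrassCurve ℚ) [W.IsElliptic] [W.IsGloballyMinimal] (p : ℕ) [Fact p.Prime],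
          ¬ (R1Population W p ∧ ¬ p ∣ W.tamagawaProduct) → P2OpenInputOnTreeAt W p := by
  refine ⟨fun h ↦ ⟨fun W _ _ p _ _ _ ↦ ?_, fun W _ _ p _ _ ↦ ?_⟩,
    fun h ↦ openInputIMC_of_r1Locus_of_rest h.1 h.2⟩
  · unfold ErratumRoadFive.OpenInputIMC at h
    exact h W p
  · unfold ErratumRoadFive.OpenInputIMC at h
    exact h W p

/-- **THE REDUCTION (class level).** Given the 11 published + 5 cited named facts of §1, the two
erratum-currency shapes at EVERY pair — H2 `∀ W p, R1.BDPValueCoreFrameOnTree W p` (THEOREM C♯) and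
H3 `∀ W p, P2.IMCDivIntCoreFrameAtErratumData W p` ((2.4)♭ ⇐ [FW21, Thm. 4.41] + Hida descent ∕ Road
HF♯) — the `R1Population ∩ Locus` part of the crux `OpenInputIMC` holds. This is the term the planner's
split `OpenInputIMC → (R1Population ∩ Locus part) ∧ (rest)` discharges modulo H2 ∧ H3.
CONDITIONAL on H2, H3 (OPEN shapes); nothing booked; no pair of class X11b is closed by this.
[cite: Castella2018Erratum, Thm. 1.1 (iii)–(iv) and (2.4) (pp. 1, 4)]
[cite: Castella2018, Thms. 2.3, 3.1, 3.2, §5 (arXiv:1704.06608 pp. 5, 9, 12)] [cite: Miller2011LMS, Def. 1.1] -/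
theorem openInputIMC_r1Locus_of_coreFrames
    (hGZ86 : GrossZagier1986_thm_I_7_3) (hGZK : rank_eq_analyticRank_of_analyticRank_le_one)
    (hSk : Skinner2016.thmC_padicValRat_bsd_rank_zero) (hnf : exists_isNewformOf)
    (hCST : CaiShuTian2014.thm11_trivialChar)
    (hFH : friedbergHoffstein_exists_twist_ne_zero_ramifiedAt)
    (hMaz : mazur_not_dvd_maninConstant_of_odd)
    (hGZ : ∀ (N : ℕ) [NeZero N] (W : WeierstrassCurve ℚ) (K : Type) [Field K] [NumberField K],
      gross_zagier N W K)
    (hKo : ∀ (N : ℕ) [NeZero N] (W : WeierstrassCurve ℚ) (K : Type) [Field K] [NumberField K],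
      kolyvagin N W K)
    (hB : ∀ (N : ℕ) [NeZero N] (W : WeierstrassCurve ℚ) (K : Type) [Field K] [NumberField K],
      Kolyvagin1990_padicValNat_card_sha_le N W K)
    (hHL : HoffsteinLuo1997_exists_twist_L_one_ne_zero)
    (hPTs : ∀ (K : Type) [Field K] [NumberField K], poitouTate_sum_localTatePairing_eq_zero K)
    (hPT : ∀ (K : Type) [Field K] [NumberField K], poitouTate_selmerStructure_duality K)
    (hPT2 : ∀ (K : Type) [Field K] [NumberField K], poitouTate_sha_tateDual K)
    (hEP : ∀ (K : Type) [Field K] [NumberField K] (v : HeightOneSpectrum (𝓞 K)),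
      localEulerPoincareCharacteristic (v.adicCompletion K))
    (hcd : fieldCdLE_two_of_numberField)
    (h2 : ∀ (W : WeierstrassCurve ℚ) [W.IsElliptic] [W.IsGloballyMinimal] (p : ℕ) [Fact p.Prime],
      R1.BDPValueCoreFrameOnTree W p)
    (h3 : ∀ (W : WeierstrassCurve ℚ) [W.IsElliptic] [W.IsGloballyMinimal] (p : ℕ) [Fact p.Prime],
      P2.IMCDivIntCoreFrameAtErratumData W p) :
    ∀ (W : WeierstrassCurve ℚ) [W.IsElliptic] [W.IsGloballyMinimal] (p : ℕ) [Fact p.Prime],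
      R1Population W p → ¬ p ∣ W.tamagawaProduct → P2OpenInputOnTreeAt W p :=
  fun W _ _ p _ hW htam ↦ openInputOnTreeAt_of_r1Population_of_not_dvd_of_coreFrames W p hGZ86 hGZK
    hSk hnf hCST hFH hMaz hGZ hKo hB hHL hPTs hPT hPT2 hEP hcd (h2 W p) (h3 W p) hW htam

/-- **The crux from the erratum currency plus its residual part.** `OpenInputIMC` follows from the
11 + 5 named facts, H2 and H3 at every pair, and the crux's own statement OFF `R1Population ∩ Locus`
(the pairs the erratum road does not reach: every `E[p]`-ramified multiplicative `q ≠ p` split, or no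
second ramified multiplicative prime, or `q = 2` only, or `E(ℚ_p)[p] ≠ 0`, or `p ∣ ∏c`, or no (ram)
prime at all). The shape of the planner's split of item 19061. CONDITIONAL; nothing booked.
[cite: Castella2018Erratum, Thm. 1.1, (2.4), Thm. A′ (pp. 1, 4)] [cite: Miller2011LMS, Def. 1.1] -/
theorem openInputIMC_of_coreFrames_of_rest
    (hGZ86 : GrossZagier1986_thm_I_7_3) (hGZK : rank_eq_analyticRank_of_analyticRank_le_one)
    (hSk : Skinner2016.thmC_padicValRat_bsd_rank_zero) (hnf : exists_isNewformOf)
    (hCST : CaiShuTian2014.thm11_trivialChar)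
    (hFH : friedbergHoffstein_exists_twist_ne_zero_ramifiedAt)
    (hMaz : mazur_not_dvd_maninConstant_of_odd)
    (hGZ : ∀ (N : ℕ) [NeZero N] (W : WeierstrassCurve ℚ) (K : Type) [Field K] [NumberField K],
      gross_zagier N W K)
    (hKo : ∀ (N : ℕ) [NeZero N] (W : WeierstrassCurve ℚ) (K : Type) [Field K] [NumberField K],
      kolyvagin N W K)
    (hB : ∀ (N : ℕ) [NeZero N] (W : WeierstrassCurve ℚ) (K : Type) [Field K] [NumberField K],
      Kolyvagin1990_padicValNat_card_sha_le N W K)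
    (hHL : HoffsteinLuo1997_exists_twist_L_one_ne_zero)
    (hPTs : ∀ (K : Type) [Field K] [NumberField K], poitouTate_sum_localTatePairing_eq_zero K)
    (hPT : ∀ (K : Type) [Field K] [NumberField K], poitouTate_selmerStructure_duality K)
    (hPT2 : ∀ (K : Type) [Field K] [NumberField K], poitouTate_sha_tateDual K)
    (hEP : ∀ (K : Type) [Field K] [NumberField K] (v : HeightOneSpectrum (𝓞 K)),
      localEulerPoincareCharacteristic (v.adicCompletion K))
    (hcd : fieldCdLE_two_of_numberField)
    (h2 : ∀ (W : WeierstrassCurve ℚ) [W.IsElliptic] [W.IsGloballyMinimal] (p : ℕ) [Fact p.Prime],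
      R1.BDPValueCoreFrameOnTree W p)
    (h3 : ∀ (W : WeierstrassCurve ℚ) [W.IsElliptic] [W.IsGloballyMinimal] (p : ℕ) [Fact p.Prime],
      P2.IMCDivIntCoreFrameAtErratumData W p)
    (hrest : ∀ (W : WeierstrassCurve ℚ) [W.IsElliptic] [W.IsGloballyMinimal] (p : ℕ) [Fact p.Prime],
      ¬ (R1Population W p ∧ ¬ p ∣ W.tamagawaProduct) → P2OpenInputOnTreeAt W p) :
    ErratumRoadFive.OpenInputIMC :=
  openInputIMC_of_r1Locus_of_rest
    (openInputIMC_r1Locus_of_coreFrames hGZ86 hGZK hSk hnf hCST hFH hMaz hGZ hKo hB hHL hPTs hPT hPT2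
      hEP hcd h2 h3) hrest

/-- **The A′-binder form at class level.** With the erratum's Thm. A′ as the OPEN binder, the
`ErratumHypotheses ∩ Locus` part of `OpenInputIMC` holds (given `hGZ hKo hSk hGZK hnf` and the cited
control facts); the A′-locus is larger than `R1Population` (no second prime, no parity of `q`) but the
evidence is the unrefereed A′ taken whole. CONDITIONAL. [claim: Castella2018Erratum, status: under-review]
[cite: JetchevSkinnerWan2017, Thm. 3.3.1 and §7.4.1] [cite: Miller2011LMS, Def. 1.1] -/
theorem openInputIMC_aprimeLocus_of_thmAprime_OPEN
    (hA' : Castella2018.erratum_thmAprime_padicVal_bsd_rankOne_OPEN)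
    (hGZ : ∀ (N : ℕ) [NeZero N] (W : WeierstrassCurve ℚ) (K : Type) [Field K] [NumberField K],
      gross_zagier N W K)
    (hKo : ∀ (N : ℕ) [NeZero N] (W : WeierstrassCurve ℚ) (K : Type) [Field K] [NumberField K],
      kolyvagin N W K)
    (hSk : Skinner2016.thmC_padicValRat_bsd_rank_zero)
    (hGZK : rank_eq_analyticRank_of_analyticRank_le_one) (hnf : exists_isNewformOf)
    (hPT : ∀ (K : Type) [Field K] [NumberField K], poitouTate_selmerStructure_duality K)
    (hPT2 : ∀ (K : Type) [Field K] [NumberField K], poitouTate_sha_tateDual K)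
    (hEP : ∀ (K : Type) [Field K] [NumberField K] (v : HeightOneSpectrum (𝓞 K)),
      localEulerPoincareCharacteristic (v.adicCompletion K))
    (hcd : fieldCdLE_two_of_numberField) :
    ∀ (W : WeierstrassCurve ℚ) [W.IsElliptic] [W.IsGloballyMinimal] (p : ℕ) [Fact p.Prime],
      ErratumHypotheses W p → ¬ p ∣ W.tamagawaProduct → P2OpenInputOnTreeAt W p :=
  fun W _ _ p _ hE htam ↦ openInputOnTreeAt_of_erratumHypotheses_of_not_dvd_of_thmAprime_OPEN W p hA'
    hGZ hKo hSk hGZK hnf hPT hPT2 hEP hcd hE htam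

end Split

end Summit.BirchSwinnertonDyer.BirchSwinnertonDyer.Theorems

end
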